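import Literature.NumberTheory.EllipticCurves.GreenbergVatsal2000.NonPrimitivePAdicLFunction
import Literature.NumberTheory.EllipticCurves.GreenbergVatsal2000.MultiplicativeReduction
import Mathlib.RingTheory.PowerSeries.Order
import Mathlib.RingTheory.PowerSeries.Inverse
import Mathlib.Algebra.Polynomial.RingDivision
import Mathlib.Algebra.CharP.Lemmas
import Mathlib.Algebra.CharP.Algebra
import Literature.RingTheory.Binomial.ChooseDivNatCast
import HarnessLib

/-!
# Class X2 / X1 (Eisenstein primes): the `Λ`-algebra behind Greenberg–Vatsal's Euler-factor elements —
# `ord_T P(a + ε)`, Frobenius `ord_T(H^{p^n} − 1) = p^n`, `ord_T((1+T)^f − 1 mod p) = p^{v_p(f)}`,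
# and the Frobenius exponent `f_ℓ`: `p^{v_p(f_ℓ)} = s_ℓ`
# (cell `b2b-bsdres`, unit `b2b-bsdres-eisenstein-p2`, gen 17; part 1 of 2, see `EulerFactorInvariants`)

HONEST FRAMING (run/shared/lean/b2b/bsd-rank1-residual/, verbatim in every file): the goal of the
cell is to DELETE the COMBINATION-SHAPED residual classes of the Birch–Swinnerton-Dyer formula for
ALL analytic-rank `≤ 1` elliptic curves over `ℚ` — "full BSD formula for every rank `≤ 1` curve in
class `C`" assembled STRICTLY from published theorems — so that the rank-`≤ 1` remainder becomes
exactly the CONSTRUCTION-SHAPED classes, which are TYPED (missing-input `Prop`s), NOT attempted.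
This is not "finishing BSD". Research route; NO CLAIM BEYOND STATED CLASSES; nothing here changes
a label. THEOREMS ONLY (no `def`, no named fact, no `sorry`).

WHY (X2-GAP §21.6 (ii), successor programme for the X2a flag `GV00-mult-asserted`): the companion
file `X2/EulerFactorInvariants.lean` proves Greenberg–Vatsal's Prop. (2.4) invariants of the
Euler-factor element `𝒫_ℓ(T) = P_ℓ(E/ℚ, ℓ⁻¹(1+T)^{f_ℓ}) ∈ Λ` (`μ = 0`, `λ = s_ℓ d_ℓ = δ_E^{(ℓ)}`) and
display (9) (`λ^{anal}_{E,Σ₀} = λ^{anal}_E + Σ δ`, `μ^{anal}_{E,Σ₀} = μ^{anal}_E`). This file holds the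
`E`-free algebra it needs:

* §0 (any field `k`): `order_aeval_C_add` — `ord_T P(a + ε) = mult_a(P) · ord_T ε` for `ε ∈ T·k⟦T⟧`
  (`P = (X − a)^d Q`, `Q(a) ≠ 0`); `order_pow_prime_pow_sub_one` — in characteristic `p`,
  `ord_T (H^{p^n} − 1) = p^n` for `H = 1 + uT + …`, `u ≠ 0` (Frobenius);
  `order_map_binomialSeries_sub_one` — `ord_T ((1 + T)^f − 1 mod p) = p^{v_p(f)}` for `0 ≠ f ∈ ℤ_p`
  (Mathlib's `PowerSeries.binomialSeries` over the binomial ring `ℤ_p`); `hasUnitContent_mul_iff`.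
* §1 (`f_ℓ = GreenbergVatsal2000.frobeniusExponent p ℓ = CyclotomicZp.ell p ℓ`): for an integer
  `ℓ > 1` prime to the ODD prime `p`, `f_ℓ ≠ 0` and `v_p(f_ℓ) + 1 = v_p(ℓ^{p−1} − 1)` — from
  `ℓ^{p−1} = γ_cyc^{(p−1) f_ℓ}` (`CyclotomicZp.cycPow_torsionOrder_mul_ell`) and Serre's lemma
  `‖γ_cyc^{x} − 1‖ = ‖x‖·‖p‖` (`PadicOneUnits.norm_oneAddPow_sub_one`); hence
  **`pow_valuation_frobeniusExponent_eq_sFactor`**: `p^{v_p(f_ℓ)} = s_ℓ`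
  (`GreenbergVatsal2000.sFactor`, "the largest power of `p` dividing `(ℓ^{p−1} − 1)/p`" = the number
  of primes of `ℚ_∞` above `ℓ`, GV Prop. (2.4) and p. 30).

References: [GreenbergVatsal2000] §1 p. 9, §2 Prop. (2.4) (p. 22), p. 30; [Serre1973] Ch. II §3.2;
[Washington1997] §7.1; HOME/b2b-bsdres-eisenstein-p2/X2-GAP.md §22.
-/

set_option autoImplicit false

noncomputable section

open scoped Classical

open Polynomial NumberField IsDedekindDomain WeierstrassCurve Literature.NumberTheory.EllipticCurves
  Literature.NumberTheory.EllipticCurves.GreenbergVatsal2000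
  Literature.NumberTheory.EllipticCurves.CyclotomicZp Literature.NumberTheory.EllipticCurves.PadicOneUnits

namespace Summit.BirchSwinnertonDyer.Rank1Residual.X2.EulerFactorAlgebra

/-! ## §0. Pure algebra: orders of `P(a + ε)`, of `H^{p^n} − 1`, and of `(1 + T)^f − 1 (mod p)` -/

section Algebra

/-- **`ord_T P(a + ε) = mult_a(P) · ord_T ε`.** For a nonzero polynomial `P` over a field `k`,
`a ∈ k` and a power series `ε` with `ε(0) = 0`: writing `P = (X − a)^d Q` with `Q(a) ≠ 0`
(`d` the root multiplicity of `a`), `P(a + ε) = ε^d · Q(a + ε)` and `Q(a + ε)` is a unit of `k⟦T⟧`. -/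
theorem order_aeval_C_add {k : Type*} [Field k] {P : k[X]} (hP : P ≠ 0) (a : k)
    {ε : PowerSeries k} (hε : PowerSeries.constantCoeff ε = 0) :
    (Polynomial.aeval (PowerSeries.C a + ε) P).order = P.rootMultiplicity a * ε.order := by
  obtain ⟨Q, hPQ, hQ⟩ := P.exists_eq_pow_rootMultiplicity_mul_and_not_dvd hP a
  set d := P.rootMultiplicity a
  have hQa : Q.eval a ≠ 0 := by
    rwa [Ne, ← Polynomial.IsRoot.def, ← Polynomial.dvd_iff_isRoot]
  have h1 : Polynomial.aeval (PowerSeries.C a + ε) P =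
      ε ^ d * Polynomial.aeval (PowerSeries.C a + ε) Q := by
    conv_lhs => rw [hPQ]
    rw [map_mul, map_pow, map_sub, Polynomial.aeval_X, Polynomial.aeval_C, PowerSeries.algebraMap_eq]
    simp
  have h2 : PowerSeries.constantCoeff (Polynomial.aeval (PowerSeries.C a + ε) Q) = Q.eval a := by
    rw [Polynomial.aeval_def, Polynomial.hom_eval₂, PowerSeries.algebraMap_eq]
    simp [hε, Polynomial.eval₂_eq_eval_map]
  have h3 : (Polynomial.aeval (PowerSeries.C a + ε) Q).order = 0 := by
    refine PowerSeries.order_zero_of_unit ?_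
    rw [PowerSeries.isUnit_iff_constantCoeff, h2]
    exact isUnit_iff_ne_zero.mpr hQa
  rw [h1, PowerSeries.order_mul, PowerSeries.order_pow, h3, add_zero, nsmul_eq_mul]

/-- **Frobenius: `ord_T (H^{p^n} − 1) = p^n`** over a field of characteristic `p`, for a power series
`H = 1 + u T + …` with `u ≠ 0`: `H = 1 + T·H₁`, `H^{p^n} = 1 + T^{p^n} H₁^{p^n}` and `H₁(0) = u ≠ 0`. -/
theorem order_pow_prime_pow_sub_one {k : Type*} [Field k] (p : ℕ) [Fact p.Prime] [CharP k p]
    (H : PowerSeries k) (h0 : PowerSeries.constantCoeff H = 1) (h1 : PowerSeries.coeff 1 H ≠ 0)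
    (n : ℕ) : (H ^ (p ^ n) - 1).order = p ^ n := by
  haveI : CharP (PowerSeries k) p :=
    charP_of_injective_ringHom (PowerSeries.C (R := k)).injective p
  set H₁ : PowerSeries k := PowerSeries.mk fun i => PowerSeries.coeff (i + 1) H with hH₁
  have hH : H = PowerSeries.X * H₁ + 1 := by
    conv_lhs => rw [PowerSeries.eq_X_mul_shift_add_const H, h0, map_one]
  have hpow : H ^ (p ^ n) - 1 = PowerSeries.X ^ (p ^ n) * H₁ ^ (p ^ n) := by
    rw [hH, add_pow_char_pow, one_pow, add_sub_cancel_right, mul_pow]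
  have hH₁ : H₁.order = 0 := by
    refine PowerSeries.order_zero_of_unit ?_
    rw [PowerSeries.isUnit_iff_constantCoeff, ← PowerSeries.coeff_zero_eq_constantCoeff_apply, hH₁,
      PowerSeries.coeff_mk, zero_add]
    exact isUnit_iff_ne_zero.mpr h1
  rw [hpow, PowerSeries.order_mul, PowerSeries.order_X_pow, PowerSeries.order_pow, hH₁, nsmul_zero,
    add_zero, Nat.cast_pow]

/-- **`ord_T ((1 + T)^f − 1 mod p) = p^{v_p(f)}`** for `0 ≠ f ∈ ℤ_p`: with `f = p^k u`, `u ∈ ℤ_pˣ`,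
`(1 + T)^f = ((1 + T)^u)^{p^k}` and `(1 + T)^u ≡ 1 + uT + … (mod p)` with `u ≢ 0`. (This is why
`𝒫_ℓ`'s `λ`-invariant carries the factor `s_ℓ = p^{v_p(f_ℓ)}` = the number of primes of `ℚ_∞` above
`ℓ`: GV Prop. (2.4).) -/
theorem order_map_binomialSeries_sub_one (p : ℕ) [Fact p.Prime] {f : ℤ_[p]} (hf : f ≠ 0) :
    (PowerSeries.map (PadicInt.toZMod (p := p)) (PowerSeries.binomialSeries ℤ_[p] f) - 1).order =
      p ^ f.valuation := by
  set u := PadicInt.unitCoeff hf with hu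
  have hfu : f = (p ^ f.valuation : ℕ) • ((u : ℤ_[p])) := by
    rw [nsmul_eq_mul, Nat.cast_pow, mul_comm]; exact PadicInt.unitCoeff_spec hf
  have hB : PowerSeries.binomialSeries ℤ_[p] f =
      PowerSeries.binomialSeries ℤ_[p] (u : ℤ_[p]) ^ (p ^ f.valuation) := by
    conv_lhs => rw [hfu]
    exact Literature.RingTheory.Binomial.binomialSeries_nsmul _ _
  rw [hB, map_pow]
  apply order_pow_prime_pow_sub_one p
  · rw [← PowerSeries.coeff_zero_eq_constantCoeff_apply, PowerSeries.coeff_map,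
      PowerSeries.binomialSeries_coeff, Ring.choose_zero_right, one_smul, map_one]
  · rw [PowerSeries.coeff_map, PowerSeries.binomialSeries_coeff, Ring.choose_one_right, smul_eq_mul,
      mul_one]
    exact ((Units.isUnit u).map (PadicInt.toZMod (p := p))).ne_zero

/-- Unit content (`μ = 0`) is multiplicative in `Λ = ℤ_p⟦T⟧`: `𝔽_p⟦T⟧` is a domain. -/
theorem hasUnitContent_mul_iff {p : ℕ} [Fact p.Prime] (a b : IwasawaAlgebra p) :
    HasUnitContent (a * b) ↔ HasUnitContent a ∧ HasUnitContent b := by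
  simp only [hasUnitContent_iff_map_toZMod_ne_zero, map_mul, mul_ne_zero_iff]

end Algebra

/-! ## §1. The Frobenius exponent `f_ℓ`: `f_ℓ ≠ 0` and `p^{v_p(f_ℓ)} = s_ℓ` -/

section FrobeniusExponent

variable (p : ℕ) [hp : Fact p.Prime]

/-- **`‖x^{p−1} − 1‖ = ‖f_x‖ · ‖p‖`** for a unit `x ∈ ℤ_pˣ` and ODD `p`: `x^{p−1} = γ_cyc^{(p−1) f_x}`
(`CyclotomicZp.cycPow_torsionOrder_mul_ell`, `t = #μ(ℤ_p) = p − 1`) and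
`‖γ_cyc^{y} − 1‖ = ‖y‖ · ‖p‖` (`PadicOneUnits.norm_oneAddPow_sub_one`, Serre's lemma; `p − 1` is a
`p`-adic unit). -/
theorem norm_pow_sub_one_eq_norm_ell_mul (hp2 : p ≠ 2) (x : ℤ_[p]ˣ) :
    ‖(x : ℤ_[p]) ^ (p - 1) - 1‖ = ‖ell p x‖ * ‖(p : ℤ_[p])‖ := by
  have he : cyclotomicExponent p = 1 := by
    rw [Literature.NumberTheory.EllipticCurves.cyclotomicExponent, if_neg hp2]
  have htor : torsionOrder p = p - 1 := by
    rw [Literature.NumberTheory.EllipticCurves.torsionOrder, he, pow_one, Nat.totient_prime hp.out]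
  have h := cycPow_torsionOrder_mul_ell p x
  rw [htor] at h
  rw [← h, cycPow, he]
  have h3 : (1 - 1) + 3 ≤ p * ((1 - 1) + 1) := by
    have := hp.out.two_le; omega
  rw [norm_oneAddPow_sub_one (p := p) (1 - 1) h3, norm_mul,
    show (1 - 1 + 1 : ℕ) = 1 from rfl, pow_one]
  have hunit : ‖((p - 1 : ℕ) : ℤ_[p])‖ = 1 := by
    rw [PadicInt.norm_natCast_eq_one_iff]
    exact (Nat.coprime_self_sub_right hp.out.one_le).mpr (Nat.coprime_one_right _)
  rw [hunit, one_mul]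

/-- For an integer `ℓ > 1`, viewed as a unit `x` of `ℤ_p`, `f_ℓ = ℓ(x) ≠ 0`: `x` is not a root of
unity (`ker ℓ = μ(ℤ_p)`, `CyclotomicZp.ell_eq_zero_iff`), since `ℓ^n = 1` in `ℤ_p ⊇ ℕ` forces
`ℓ = 1`. -/
theorem ell_ne_zero_of_val_eq_natCast {ℓ : ℕ} (h1 : 1 < ℓ) (x : ℤ_[p]ˣ) (hx : (x : ℤ_[p]) = ℓ) :
    ell p x ≠ 0 := by
  rw [Ne, ell_eq_zero_iff, isOfFinOrder_iff_pow_eq_one]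
  rintro ⟨n, hn, hxn⟩
  have h : ((ℓ ^ n : ℕ) : ℤ_[p]) = ((1 : ℕ) : ℤ_[p]) := by
    rw [Nat.cast_pow, ← hx, ← Units.val_pow_eq_pow_val, hxn, Units.val_one, Nat.cast_one]
  have h' : ℓ ^ n = 1 := Nat.cast_injective h
  have : 1 < ℓ ^ n := Nat.one_lt_pow hn.ne' h1
  omega

/-- **`v_p(f_ℓ) + 1 = v_p(ℓ^{p−1} − 1)`** for an integer `ℓ > 1` prime to the odd prime `p` (both
sides read off `‖ℓ^{p−1} − 1‖ = ‖f_ℓ‖·‖p‖`). -/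
theorem valuation_ell_add_one (hp2 : p ≠ 2) {ℓ : ℕ} (h1 : 1 < ℓ) (x : ℤ_[p]ˣ)
    (hx : (x : ℤ_[p]) = ℓ) :
    (ell p x).valuation + 1 = padicValNat p (ℓ ^ (p - 1) - 1) := by
  have hne := ell_ne_zero_of_val_eq_natCast p h1 x hx
  have hnorm := norm_pow_sub_one_eq_norm_ell_mul p hp2 x
  have hcast : ((x : ℤ_[p]) ^ (p - 1) - 1) = ((ℓ ^ (p - 1) - 1 : ℕ) : ℤ_[p]) := by
    rw [hx, Nat.cast_sub (Nat.one_le_pow _ _ (by omega)), Nat.cast_pow, Nat.cast_one]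
  have hN : ℓ ^ (p - 1) - 1 ≠ 0 := by
    have : 1 < ℓ ^ (p - 1) := Nat.one_lt_pow (by have := hp.out.two_le; omega) h1
    omega
  have hN' : ((ℓ ^ (p - 1) - 1 : ℕ) : ℤ_[p]) ≠ 0 := by exact_mod_cast hN
  rw [hcast, PadicInt.norm_eq_zpow_neg_valuation hN', PadicInt.norm_eq_zpow_neg_valuation hne,
    PadicInt.norm_p, ← zpow_neg_one, ← zpow_add₀ (by exact_mod_cast hp.out.ne_zero)] at hnorm
  have hinj := (zpow_right_strictMono₀ (a := (p : ℝ)) (by exact_mod_cast hp.out.one_lt)).injective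
    hnorm
  have hval : ((ℓ ^ (p - 1) - 1 : ℕ) : ℤ_[p]).valuation = padicValNat p (ℓ ^ (p - 1) - 1) := by
    have := PadicInt.valuation_coe ((ℓ ^ (p - 1) - 1 : ℕ) : ℤ_[p])
    rw [PadicInt.coe_natCast, Padic.valuation_natCast] at this
    exact_mod_cast this.symm
  rw [← hval]
  omega

variable {p}

/-- An integer prime to `p` is a unit of `ℤ_p`. -/
theorem isUnit_natCast_of_coprime {ℓ : ℕ} (hℓ : p.Coprime ℓ) : IsUnit (ℓ : ℤ_[p]) :=
  PadicInt.isUnit_iff.mpr (PadicInt.norm_natCast_eq_one_iff.mpr hℓ)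

/-- **`f_ℓ ≠ 0`** for an integer `ℓ > 1` prime to `p` (`frobeniusExponent p ℓ = ℓ(ℓ)`). -/
theorem frobeniusExponent_natCast_ne_zero {ℓ : ℕ} (hℓ : p.Coprime ℓ) (h1 : 1 < ℓ) :
    frobeniusExponent p (ℓ : ℤ_[p]) ≠ 0 := by
  rw [frobeniusExponent_of_isUnit (isUnit_natCast_of_coprime hℓ)]
  exact ell_ne_zero_of_val_eq_natCast p h1 _ (IsUnit.unit_spec _)

/-- **`v_p(f_ℓ) + 1 = v_p(ℓ^{p−1} − 1)`** for `frobeniusExponent`, `ℓ > 1` prime to the odd prime `p`. -/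
theorem valuation_frobeniusExponent_natCast_add_one (hp2 : p ≠ 2) {ℓ : ℕ} (hℓ : p.Coprime ℓ)
    (h1 : 1 < ℓ) :
    (frobeniusExponent p (ℓ : ℤ_[p])).valuation + 1 = padicValNat p (ℓ ^ (p - 1) - 1) := by
  rw [frobeniusExponent_of_isUnit (isUnit_natCast_of_coprime hℓ)]
  exact valuation_ell_add_one p hp2 h1 _ (IsUnit.unit_spec _)

/-- **`p^{v_p(f_ℓ)} = s_ℓ`** (`GreenbergVatsal2000.sFactor p ℓ = p^{v_p(ℓ^{p−1}−1) − 1}`, "the largest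
power of `p` dividing `(ℓ^{p−1} − 1)/p`" = the number of primes of `ℚ_∞` above `ℓ`), for `ℓ > 1`
prime to the odd prime `p`. -/
theorem pow_valuation_frobeniusExponent_eq_sFactor (hp2 : p ≠ 2) {ℓ : ℕ} (hℓ : p.Coprime ℓ)
    (h1 : 1 < ℓ) : p ^ (frobeniusExponent p (ℓ : ℤ_[p])).valuation = sFactor p ℓ := by
  rw [sFactor, ← valuation_frobeniusExponent_natCast_add_one hp2 hℓ h1, Nat.add_sub_cancel]

end FrobeniusExponent

end Summit.BirchSwinnertonDyer.Rank1Residual.X2.EulerFactorAlgebra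

end
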